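import Literature.Barriers.Parity.SiegelZeroPrimePairsMainTermCutoff
import Literature.NumberTheory.Sieve.DyadicPartitionOfUnity
import HarnessLib

/-!
# Matomäki–Merikoski §7, main terms: the dyadic cutoff `∑_{M = 2^j ≤ 2^b} F(m/M)` and partial summation

Sibling of `SiegelZeroPrimePairsMainTermCutoff.lean` (the abstract partial-summation step) and of the tree's
`Sieve/DyadicPartitionOfUnity.lean` (`F = dyadicBump`, `Ψ = smoothStep`, `∑_{a ≤ j ≤ b} F(x/2^j) = Ψ(x/2^a) − Ψ(x/2^{b+1})`).
Everything here is PROVED (theorems only).  In §7 of Matomäki–Merikoski (arXiv:2112.11412, p. 20–21) the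
`m₁`-sum of the main term `Σ̃_{S,S}` carries the weight `∑_{M₁ = 2^{i}, 1/4 ≤ M₁ ≤ X^{1/2}} F(m₁/M₁)`, which is
"`1` if `m₁ ≤ X^{1/2}/4`, `0` if `m₁ ≥ 4X^{1/2}`" (first display of p. 21), and "by partial summation and Lemma 2.4"
the weighted sum is `(1 + O(𝓔)) ∏_{p<z}(1 − 1/p)^{−1}`.  We prove:

* `MatomakiMerikoski.sum_dyadicBump_cutoff_eq` — for an integer `n ≥ 1` and `b : ℕ`,
  `∑_{−2 ≤ j ≤ b} F(n/2^j) = 1 − Ψ(n/2^{b+1})` (so the cutoff is `1` for `n ≤ 2^{b+1}`, `0` for `n ≥ 2^{b+2}`,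
  and antitone in between);
* `MatomakiMerikoski.abs_sum_mul_dyadicCutoff_sub_le` — if `|∑_{n ≤ N} g(n) − V| ≤ εV` for all integers
  `2^{b+1} ≤ N ≤ 2^{b+2}`, then `|∑_{1 ≤ n ≤ L} g(n) (∑_{−2 ≤ j ≤ b} F(n/2^j)) − V| ≤ εV` for every `L ≥ 2^{b+2}`
  (the partial-summation step of the source, from `abs_sum_mul_cutoff_sub_le`).

## References

* K. Matomäki, J. Merikoski, IMRN 2023:23, 20337–20384 (arXiv:2112.11412), §7, evaluation of `Σ̃_{S,S}`
  (p. 21, first two displays and "by partial summation and Lemmas 2.4 and 2.5").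
  [cite: MatomakiMerikoski2023, §7 (main term of Σ_{S,S})]
-/

noncomputable section

open Finset

namespace Literature.Barriers.Parity.MatomakiMerikoski

open Literature.NumberTheory.Sieve

/-- **The dyadic cutoff in closed form.**  For a natural `n ≥ 1` and `b : ℕ`:
`∑_{−2 ≤ j ≤ b} F(n/2^j) = 1 − Ψ(n/2^{b+1})` (`F = dyadicBump`, `Ψ = smoothStep`; the first boundary term is
`Ψ(4n) = 1`). [cite: MatomakiMerikoski2023, §7 (p. 21, first display)] -/
theorem sum_dyadicBump_cutoff_eq (b : ℕ) {n : ℕ} (hn : 1 ≤ n) :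
    ∑ j ∈ Finset.Icc (-2 : ℤ) b, dyadicBump ((n : ℝ) / (2 : ℝ) ^ j) =
      1 - smoothStep ((n : ℝ) / ((2 ^ (b + 1) : ℕ) : ℝ)) := by
  have hb : (-2 : ℤ) ≤ (b : ℤ) := by omega
  rw [sum_Icc_dyadicBump hb]
  have hn1 : (1 : ℝ) ≤ n := by exact_mod_cast hn
  have h1 : smoothStep ((n : ℝ) / (2 : ℝ) ^ (-2 : ℤ)) = 1 := by
    refine smoothStep_of_two_le ?_
    rw [zpow_neg, div_inv_eq_mul, show ((2 : ℝ) ^ (2 : ℤ)) = 4 by norm_num]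
    linarith
  have h2 : ((2 : ℝ)) ^ ((b : ℤ) + 1) = (((2 ^ (b + 1) : ℕ)) : ℝ) := by
    rw [show ((b : ℤ) + 1) = ((b + 1 : ℕ) : ℤ) by push_cast; ring, zpow_natCast]
    push_cast; ring
  rw [h1, h2]

/-- The closed form as a function on `ℕ` (value `1` at `n = 0` as well). [folklore] -/
theorem one_sub_smoothStep_props (b : ℕ) :
    (∀ n : ℕ, n ≤ 2 ^ (b + 1) → 1 - smoothStep ((n : ℝ) / ((2 ^ (b + 1) : ℕ) : ℝ)) = 1) ∧
    (∀ n : ℕ, 2 ^ (b + 2) < n → 1 - smoothStep ((n : ℝ) / ((2 ^ (b + 1) : ℕ) : ℝ)) = 0) ∧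
    (∀ n : ℕ, 1 - smoothStep (((n + 1 : ℕ) : ℝ) / ((2 ^ (b + 1) : ℕ) : ℝ)) ≤
      1 - smoothStep ((n : ℝ) / ((2 ^ (b + 1) : ℕ) : ℝ))) := by
  have hP : (0 : ℝ) < ((2 ^ (b + 1) : ℕ) : ℝ) := by positivity
  refine ⟨fun n hn => ?_, fun n hn => ?_, fun n => ?_⟩
  · rw [smoothStep_of_le_one, sub_zero]
    rw [div_le_one hP]; exact_mod_cast hn
  · rw [smoothStep_of_two_le, sub_self]
    rw [le_div_iff₀ hP]
    have : 2 * 2 ^ (b + 1) < n := by rw [← pow_succ']; simpa [pow_succ] using hn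
    have : ((2 * 2 ^ (b + 1) : ℕ) : ℝ) ≤ n := by exact_mod_cast this.le
    push_cast at this ⊢
    linarith
  · have hmono := smoothStep_monotone (show (n : ℝ) / ((2 ^ (b + 1) : ℕ) : ℝ) ≤
        ((n + 1 : ℕ) : ℝ) / ((2 ^ (b + 1) : ℕ) : ℝ) from
      div_le_div_of_nonneg_right (by push_cast; linarith) hP.le)
    linarith

/-- **Partial summation against the dyadic cutoff** (Matomäki–Merikoski §7, "by partial summation"):
if the partial sums of `g` satisfy `|∑_{1 ≤ n ≤ N} g(n) − V| ≤ ε V` for all integers `2^{b+1} ≤ N ≤ 2^{b+2}`,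
then for every `L ≥ 2^{b+2}`,
`|∑_{1 ≤ n ≤ L} g(n) ∑_{−2 ≤ j ≤ b} F(n/2^j) − V| ≤ ε V`.
[cite: MatomakiMerikoski2023, §7 (main term of Σ_{S,S}, "by partial summation and Lemma 2.4")] -/
theorem abs_sum_mul_dyadicCutoff_sub_le {g : ℕ → ℝ} {V ε : ℝ} (b : ℕ) {L : ℕ} (hL : 2 ^ (b + 2) ≤ L)
    (hA : ∀ N : ℕ, 2 ^ (b + 1) ≤ N → N ≤ 2 ^ (b + 2) → |∑ n ∈ Icc 1 N, g n - V| ≤ ε * V) :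
    |∑ n ∈ Icc 1 L, g n * ∑ j ∈ Finset.Icc (-2 : ℤ) b, dyadicBump ((n : ℝ) / (2 : ℝ) ^ j) - V| ≤
      ε * V := by
  obtain ⟨hw1, hw0, hanti⟩ := one_sub_smoothStep_props b
  set w : ℕ → ℝ := fun n => 1 - smoothStep ((n : ℝ) / ((2 ^ (b + 1) : ℕ) : ℝ)) with hw
  -- replace the dyadic sum by the closed form, and cut the range at `2^{b+2}`
  have hsub : Icc 1 (2 ^ (b + 2)) ⊆ Icc 1 L := by
    intro n hn; rw [mem_Icc] at hn ⊢; omega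
  have heq : ∑ n ∈ Icc 1 L, g n * ∑ j ∈ Finset.Icc (-2 : ℤ) b, dyadicBump ((n : ℝ) / (2 : ℝ) ^ j) =
      ∑ n ∈ Icc 1 (2 ^ (b + 2)), g n * w n := by
    rw [← sum_subset hsub]
    · refine sum_congr rfl fun n hn => ?_
      rw [mem_Icc] at hn
      rw [sum_dyadicBump_cutoff_eq b hn.1]
    · intro n hn hn'
      rw [mem_Icc] at hn hn'
      have hlt : 2 ^ (b + 2) < n := by omega
      rw [sum_dyadicBump_cutoff_eq b hn.1, hw0 n hlt, mul_zero]
  rw [heq]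
  have h1 : 1 ≤ 2 ^ (b + 1) := Nat.one_le_two_pow
  have h12 : 2 ^ (b + 1) ≤ 2 ^ (b + 2) := Nat.pow_le_pow_right (by norm_num) (by omega)
  exact abs_sum_mul_cutoff_sub_le (a := g) (w := w) h1 h12 hw1 hw0
    (fun n _ => hanti n) hA

end Literature.Barriers.Parity.MatomakiMerikoski
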